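import Literature.MathematicalPhysics.QuantumLattice.GrassmannParity
import Literature.MathematicalPhysics.QuantumLattice.GrassmannEffectiveAction

/-!
# Parity calculus for Salmhofer's `Δ_C` machinery

Support for the seed Ward identity of crux stmt-14047 (line seed-ward-action): the left Grassmann
derivative `∂_X` flips parity; hence the fermionic Laplacian `Δ_C`, the Gaussian convolution
`e^{Δ_C}`, the effective Boltzmann factor `μ_C ⋆ e^{-V}` and the effective action preserve the
even part of the Grassmann algebra.
-/

set_option linter.dupNamespace false

namespace Summit.HubbardSuperconductivity.HubbardSuperconductivity.Theorems.AposterioriCapRgSeededBrokenRegimeBoseFermiPinned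

open Literature.MathematicalPhysics.QuantumLattice GrassmannAlgebra

/-- Transport of a parity membership along an equality of the `ZMod 2` indices. [folklore] -/
theorem mem_evenOdd_of_index_eq {Γ : Type} {i j : ZMod 2} (hij : i = j) {x : GrassmannAlgebra ℂ Γ}
    (hx : x ∈ GrassmannAlgebra.evenOdd ℂ i) : x ∈ GrassmannAlgebra.evenOdd ℂ j :=
  hij ▸ hx

/-- Left multiplication by a degree-one element `ι v = Σ_Y v(Y) ψ(Y)` flips parity. [folklore] -/
theorem ι_mul_mem_evenOdd_add_one {Γ : Type} (v : Γ → ℂ) {i : ZMod 2} {x : GrassmannAlgebra ℂ Γ}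
    (hx : x ∈ GrassmannAlgebra.evenOdd ℂ i) :
    ExteriorAlgebra.ι ℂ v * x ∈ GrassmannAlgebra.evenOdd ℂ (i + 1) :=
  mem_evenOdd_of_index_eq (add_comm _ _) (SetLike.mul_mem_graded (CliffordAlgebra.ι_mem_evenOdd_one _ v) hx)

/-- The inductive step of the parity computation of `∂_X`: the graded Leibniz rule on
`ι m₁ · ι m₂ · x`. [folklore] -/
theorem grassmannDeriv_ι_mul_ι_mul_mem_evenOdd {Γ : Type} (X : Γ) (m₁ m₂ : Γ → ℂ) {i : ZMod 2}
    {x : GrassmannAlgebra ℂ Γ} (hx : x ∈ GrassmannAlgebra.evenOdd ℂ i)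
    (ih : grassmannDeriv ℂ X x ∈ GrassmannAlgebra.evenOdd ℂ (i + 1)) :
    grassmannDeriv ℂ X (ExteriorAlgebra.ι ℂ m₁ * ExteriorAlgebra.ι ℂ m₂ * x) ∈
      GrassmannAlgebra.evenOdd ℂ (i + 1) := by
  have h2 : ∀ j : ZMod 2, j + 1 + 1 = j := by decide
  rw [mul_assoc, grassmannDeriv_ι_mul, grassmannDeriv_ι_mul]
  exact Submodule.sub_mem _ (Submodule.smul_mem _ _ (ι_mul_mem_evenOdd_add_one m₂ hx))
    (ι_mul_mem_evenOdd_add_one m₁ (Submodule.sub_mem _ (Submodule.smul_mem _ _ hx)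
      (mem_evenOdd_of_index_eq (h2 i) (ι_mul_mem_evenOdd_add_one m₂ ih))))

/-- **The left Grassmann derivative `∂/∂ψ(X)` flips parity**: it maps the part of parity `i` to
the part of parity `i + 1` (it lowers the degree of every monomial by one; Berezin 1966,
Ch. I §3). [folklore] -/
theorem grassmannDeriv_mem_evenOdd :
    ∀ {Γ : Type} (X : Γ) {i : ZMod 2} {a : GrassmannAlgebra ℂ Γ}, a ∈ GrassmannAlgebra.evenOdd ℂ i →
      grassmannDeriv ℂ X a ∈ GrassmannAlgebra.evenOdd ℂ (i + 1) := by
  intro Γ X i a ha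
  have hcases : ∀ j : ZMod 2, j = 0 ∨ j = 1 := by decide
  rcases hcases i with rfl | rfl
  · induction a, ha using CliffordAlgebra.even_induction with
    | algebraMap r => rw [grassmannDeriv_algebraMap]; exact Submodule.zero_mem _
    | add x y hx hy ihx ihy => rw [map_add]; exact Submodule.add_mem _ ihx ihy
    | ι_mul_ι_mul m₁ m₂ x hx ih => exact grassmannDeriv_ι_mul_ι_mul_mem_evenOdd X m₁ m₂ hx ih
  · induction a, ha using CliffordAlgebra.odd_induction with
    | ι v => rw [grassmannDeriv_ι]; exact mem_evenOdd_of_index_eq (by decide) (SetLike.algebraMap_mem_graded _ _)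
    | add x y hx hy ihx ihy => rw [map_add]; exact Submodule.add_mem _ ihx ihy
    | ι_mul_ι_mul m₁ m₂ x hx ih => exact grassmannDeriv_ι_mul_ι_mul_mem_evenOdd X m₁ m₂ hx ih

/-- **The fermionic Laplacian `Δ_C = ½ Σ C(X,Y) ∂_X ∂_Y` preserves parity** (two derivatives;
Salmhofer 1999, (4.86)). [folklore] -/
theorem grassmannLaplacian_mem_evenOdd :
    ∀ {Γ : Type} [Fintype Γ] (C : Matrix Γ Γ ℂ) {i : ZMod 2} {a : GrassmannAlgebra ℂ Γ},
      a ∈ GrassmannAlgebra.evenOdd ℂ i → grassmannLaplacian ℂ C a ∈ GrassmannAlgebra.evenOdd ℂ i := by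
  intro Γ _ C i a ha
  have h2 : ∀ j : ZMod 2, j + 1 + 1 = j := by decide
  rw [grassmannLaplacian_apply]
  exact Submodule.smul_mem _ _ (Submodule.sum_mem _ fun X _ => Submodule.sum_mem _ fun Y _ =>
    Submodule.smul_mem _ _ (mem_evenOdd_of_index_eq (h2 i)
      (grassmannDeriv_mem_evenOdd X (grassmannDeriv_mem_evenOdd Y ha))))

/-- Powers of the fermionic Laplacian preserve parity. [folklore] -/
theorem grassmannLaplacian_pow_mem_evenOdd {Γ : Type} [Fintype Γ] (C : Matrix Γ Γ ℂ) {i : ZMod 2}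
    {a : GrassmannAlgebra ℂ Γ} (ha : a ∈ GrassmannAlgebra.evenOdd ℂ i) (k : ℕ) :
    (grassmannLaplacian ℂ C ^ k) a ∈ GrassmannAlgebra.evenOdd ℂ i := by
  induction k with
  | zero => rw [pow_zero, Module.End.one_apply]; exact ha
  | succ k ih => rw [pow_succ', Module.End.mul_apply]; exact grassmannLaplacian_mem_evenOdd C ih

/-- **The Gaussian convolution `μ_C ⋆ = e^{Δ_C}` preserves parity** (a finite sum of powers of
`Δ_C`; Salmhofer 1999, Prop. 4.3 (4.88)). [folklore] -/
theorem gaussConv_mem_evenOdd :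
    ∀ {Γ : Type} [Fintype Γ] (C : Matrix Γ Γ ℂ) {i : ZMod 2} {a : GrassmannAlgebra ℂ Γ},
      a ∈ GrassmannAlgebra.evenOdd ℂ i → gaussConv ℂ C a ∈ GrassmannAlgebra.evenOdd ℂ i := by
  intro Γ _ C i a ha
  obtain ⟨k, hk⟩ := isNilpotent_grassmannLaplacian ℂ C
  rw [gaussConv_def, IsNilpotent.exp_eq_sum hk, LinearMap.coe_sum, Finset.sum_apply]
  refine Submodule.sum_mem _ fun n _ => ?_
  rw [LinearMap.smul_apply]
  exact Submodule.smul_of_tower_mem _ _ (grassmannLaplacian_pow_mem_evenOdd C ha n)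

/-- The exponential of an even element is even (no nilpotency hypothesis: for a non-nilpotent
element `grassmannExp` is the empty sum). [folklore] -/
theorem grassmannExp_mem_evenOdd_zero' {Γ : Type} {x : GrassmannAlgebra ℂ Γ}
    (hx : x ∈ GrassmannAlgebra.evenOdd ℂ 0) : grassmannExp x ∈ GrassmannAlgebra.evenOdd ℂ 0 := by
  by_cases hn : IsNilpotent x
  · exact grassmannExp_mem_evenOdd_zero ℂ hx hn
  · rw [grassmannExp, IsNilpotent.exp, Nat.eq_zero_of_not_pos (mt isNilpotent_of_pos_nilpotencyClass hn),
      Finset.range_zero, Finset.sum_empty]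
    exact Submodule.zero_mem _

/-- **The effective Boltzmann factor `μ_C ⋆ e^{-V}` of an even interaction is even.** [folklore] -/
theorem effBoltzmann_mem_evenOdd_zero :
    ∀ {Γ : Type} [Fintype Γ] (C : Matrix Γ Γ ℂ) {V : GrassmannAlgebra ℂ Γ}, V ∈ GrassmannAlgebra.evenOdd ℂ 0 →
      effBoltzmann ℂ C V ∈ GrassmannAlgebra.evenOdd ℂ 0 := by
  intro Γ _ C V hV
  rw [effBoltzmann_def]
  exact gaussConv_mem_evenOdd C (grassmannExp_mem_evenOdd_zero' (Submodule.neg_mem _ hV))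

/-- The truncated logarithm `log (1 + x) = Σ_{k ≥ 1} (-1)^{k+1} x^k / k` of an even element is
even. [folklore] -/
theorem grassmannLog1p_mem_evenOdd_zero {Γ : Type} {x : GrassmannAlgebra ℂ Γ}
    (hx : x ∈ GrassmannAlgebra.evenOdd ℂ 0) : grassmannLog1p ℂ x ∈ GrassmannAlgebra.evenOdd ℂ 0 := by
  rw [grassmannLog1p]
  exact Submodule.sum_mem _ fun k _ => Submodule.smul_of_tower_mem _ _ (pow_mem_evenOdd_zero ℂ hx k)

/-- **The Wilsonian effective action `-log (Z⁻¹ μ_C ⋆ e^{-V})` of an even interaction is even**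
(Benfatto–Giuliani–Mastropietro 2006, (2.17)–(2.18): the effective potentials are even on every
scale). [folklore] -/
theorem effAction_mem_evenOdd_zero :
    ∀ {Γ : Type} [Fintype Γ] (C : Matrix Γ Γ ℂ) {V : GrassmannAlgebra ℂ Γ}, V ∈ GrassmannAlgebra.evenOdd ℂ 0 →
      effAction ℂ C V ∈ GrassmannAlgebra.evenOdd ℂ 0 := by
  intro Γ _ C V hV
  rw [effAction_def]
  exact Submodule.neg_mem _ (grassmannLog1p_mem_evenOdd_zero (Submodule.sub_mem _
    (Submodule.smul_mem _ _ (effBoltzmann_mem_evenOdd_zero C hV)) (one_mem_evenOdd_zero ℂ)))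

end Summit.HubbardSuperconductivity.HubbardSuperconductivity.Theorems.AposterioriCapRgSeededBrokenRegimeBoseFermiPinned
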